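import Summits.BirchSwinnertonDyer.BirchSwinnertonDyer.Theorems.SylvesterTwoHeegnerIndexThmCAssembly
import HarnessLib

/-!
# Route `SylvesterTwoHeegnerIndex` (rung K7t): the child `TwoAdicPairHSYOfFactsPlusOfThmC` (item 19803)
# of the cascade-E2 split of crux `HeegnerIndexUpperAtTwoHSYOfFactsPlus` (item 19725)

Cell «bsd-cm» (`run/shared/lean/pub/bsd-cm/`). Filed by seat `bsd-cm-k7t-c3` (prover, gen 6) with the
closer STAGED BY x1b GEN 49/50 (cell b2b-bsdres; `HOME(b2b)/b2b-bsdres-x1b/gen49/lean/…OfThmC.lean`,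
STATUS 18:15:04Z / 21:36:51Z «any live K7t hand may do it first»), verbatim. HONEST FRAMING: this file
is COMPOSITION ONLY. The item says: granted `PublishedFactsTwoPlus` (the route's published facts +
Hu–Shu–Yin's printed height display) and the cell's THEOREM C (`HSYPointTwoDivisibleSevenModNine`,
item 19802, refereed, NOT in print, NOT kernel — a HYPOTHESIS here), the `2`-adic pair statement
`TwoAdicPairHSY` holds: for every member/partner pair `(B ≅ E_p, A ≅ E_{3p²})`, `#Ш_an(B)·#Ш_an(A)` is
a non-zero rational of EVEN `2`-adic valuation `2n`. The proof is x1b's landed assembly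
`SylvesterTwoThmCAssembly.twoAdicPairHSY_of_heightDisplay_of_thmC` (p456911), itself composed of
bsd-cm-two's `SylvesterTwoNonneg.exists_nat_padicValRat_two_eq_of_model_of_thmC` (p445456) and x1b's
parity `twoAdicPairHSY_parity` (p447552). Nothing is asserted about THEOREM C or the facts. Closes no
cell; BSD is not claimed.

PARTITION (D-0054): CornerF at `p = 2` (B14/O12) × 𝒞_HSY (`E_p : x³ + y³ = p`, `p ≡ 4, 7 (mod 9)`
prime, `3 ∉ 𝔽_p^{×3}`) × `p = 2` — types-the-object-of (closes the r202 child of the E2 split only;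
moves no label).
-/

-- the Theorems namespace `Summit.BirchSwinnertonDyer.BirchSwinnertonDyer.…` repeats a component by design (D-0017 layout)
set_option linter.dupNamespace false

namespace Summit.BirchSwinnertonDyer.BirchSwinnertonDyer.Theorems

open Summit.BirchSwinnertonDyer.BirchSwinnertonDyer.Theses.SylvesterTwoHeegnerIndex

/-- **Item 19803 `TwoAdicPairHSYOfFactsPlusOfThmC`**: `PublishedFactsTwoPlus → THEOREM C →
TwoAdicPairHSY`, by x1b GEN 49's landed assembly `twoAdicPairHSY_of_heightDisplay_of_thmC` applied
to the height-display conjunct of the antecedent and to THEOREM C. Composition only (x1b's staged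
term, verbatim). [cite: HuShuYin2019, Cor. 4.4 and (bsd) p. 12] -/
theorem twoAdicPairHSYOfFactsPlusOfThmC_proof : TwoAdicPairHSYOfFactsPlusOfThmC :=
  fun hFP hT => SylvesterTwoThmCAssembly.twoAdicPairHSY_of_heightDisplay_of_thmC hFP.2 hT

end Summit.BirchSwinnertonDyer.BirchSwinnertonDyer.Theorems
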